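import Mathlib

/-!
# `SnSubsetDichotomy.PolynomialSlack`, line `quotient-globalisation-by-pruning` — the ALIGNMENT IDENTITY
(first rung of the line; helper lemmas `--supports stmt-MatrixMultiplication-8306`)

For finite `S, T ⊆ S_n` and `t`-tuples `I J : Fin t → Fin n`, an element `s⁻¹ * t` of the quotient set
`S⁻¹T` lies in the umvirate `U_{I→J} = {σ | ∀ k, σ (I k) = J k}` iff `t ∘ I = s ∘ J` (both equal to a
common TARGET tuple `L`).  Hence, when the quotient is FULL (`|S⁻¹T| = |S||T|`, i.e. `(s,t) ↦ s⁻¹t` is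
injective on `S × T` — the pairwise part of the triple product property),
`|S⁻¹T ∩ U_{I→J}| = Σ_L |S ∩ U_{J→L}| · |T ∩ U_{I→L}|` (`card_quot_filter_eq_sum`), and therefore
`|S⁻¹T ∩ U_{I→J}| ≤ |T| · max_L |S ∩ U_{J→L}|` and `≤ |S| · max_L |T ∩ U_{I→L}|`
(`card_quot_filter_le_left/right`): a density bump of a full quotient on a `t`-umvirate is at most the
largest density bump of EITHER factor at the same level — "the quotient is as global as its most global
factor" (line card, First rung; Keevash–Lifshitz arXiv:2307.15030 §1 for the vocabulary).  Pure finite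
combinatorics; no fact is used.
-/

open scoped BigOperators
open Finset

-- `Summit.<Summit>.<Problem>`: single-problem summit, the duplicate component is the tree's convention.
set_option linter.dupNamespace false

namespace Summit.MatrixMultiplication.MatrixMultiplication.Theorems.PolynomialSlack

/-- Membership of a quotient `s⁻¹ * t` in the umvirate `U_{I→J}`: `(s⁻¹ * t) (I k) = J k` for all `k`
iff `t (I k) = s (J k)` for all `k`. [folklore] -/
theorem inv_mul_mem_umvirate_iff {n t : ℕ} (s τ : Equiv.Perm (Fin n)) (I J : Fin t → Fin n) :
    (∀ k, (s⁻¹ * τ) (I k) = J k) ↔ ∀ k, τ (I k) = s (J k) := by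
  refine forall_congr' fun k => ?_
  rw [Equiv.Perm.mul_apply, Equiv.Perm.inv_eq_iff_eq]

/-- **Alignment identity.** If `(s,t) ↦ s⁻¹ * t` is injective on `S × T` (full quotient), then for
all tuples `I J : Fin t → Fin n`,
`|S⁻¹T ∩ U_{I→J}| = Σ_{L : Fin t → Fin n} |S ∩ U_{J→L}| · |T ∩ U_{I→L}|`:
partition the pairs `(s,t)` with `t ∘ I = s ∘ J` according to the common value `L = s ∘ J`.
[folklore] -/
theorem card_quot_filter_eq_sum {n t : ℕ} (S T : Finset (Equiv.Perm (Fin n)))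
    (hinj : Set.InjOn (fun st : Equiv.Perm (Fin n) × Equiv.Perm (Fin n) => st.1⁻¹ * st.2)
      ((S : Set (Equiv.Perm (Fin n))) ×ˢ (T : Set (Equiv.Perm (Fin n)))))
    (I J : Fin t → Fin n) :
    ((Finset.image₂ (fun s τ => s⁻¹ * τ) S T).filter (fun σ => ∀ k, σ (I k) = J k)).card =
      ∑ L : Fin t → Fin n,
        (S.filter (fun s => ∀ k, s (J k) = L k)).card * (T.filter (fun τ => ∀ k, τ (I k) = L k)).card := by
  classical
  -- the filtered quotient is the injective image of the set of ALIGNED pairs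
  set P : Finset (Equiv.Perm (Fin n) × Equiv.Perm (Fin n)) :=
    (S ×ˢ T).filter (fun st => ∀ k, st.2 (I k) = st.1 (J k)) with hP
  have himage : (Finset.image₂ (fun s τ => s⁻¹ * τ) S T).filter (fun σ => ∀ k, σ (I k) = J k) =
      P.image (fun st => st.1⁻¹ * st.2) := by
    ext σ
    simp only [mem_filter, mem_image₂, mem_image, hP, mem_product]
    constructor
    · rintro ⟨⟨s, hs, τ, hτ, rfl⟩, hk⟩
      exact ⟨(s, τ), ⟨⟨hs, hτ⟩, (inv_mul_mem_umvirate_iff s τ I J).1 hk⟩, rfl⟩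
    · rintro ⟨⟨s, τ⟩, ⟨⟨hs, hτ⟩, hk⟩, rfl⟩
      exact ⟨⟨s, hs, τ, hτ, rfl⟩, (inv_mul_mem_umvirate_iff s τ I J).2 hk⟩
  have hPsub : (P : Set (Equiv.Perm (Fin n) × Equiv.Perm (Fin n))) ⊆
      (S : Set (Equiv.Perm (Fin n))) ×ˢ (T : Set (Equiv.Perm (Fin n))) := by
    intro x hx
    rw [← coe_product]
    exact (mem_filter.1 (mem_coe.1 hx)).1
  rw [himage, card_image_of_injOn (hinj.mono hPsub)]
  -- partition the aligned pairs by the common target `L = s ∘ J`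
  rw [card_eq_sum_card_fiberwise (f := fun st : Equiv.Perm (Fin n) × Equiv.Perm (Fin n) =>
      fun k => st.1 (J k)) (t := (Finset.univ : Finset (Fin t → Fin n)))
      (fun _ _ => mem_univ _)]
  refine sum_congr rfl fun L _ => ?_
  rw [← card_product]
  congr 1
  ext ⟨s, τ⟩
  simp only [hP, mem_filter, mem_product]
  constructor
  · rintro ⟨⟨⟨hs, hτ⟩, hk⟩, hL⟩
    have hL' : ∀ k, s (J k) = L k := fun k => congrFun hL k
    exact ⟨⟨hs, hL'⟩, hτ, fun k => (hk k).trans (hL' k)⟩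
  · rintro ⟨⟨hs, hsL⟩, hτ, hτL⟩
    exact ⟨⟨⟨hs, hτ⟩, fun k => (hτL k).trans (hsL k).symm⟩, funext hsL⟩

/-- The target laws sum to the whole set: `Σ_L |X ∩ U_{I→L}| = |X|` (every `x` has exactly one
target tuple `L = x ∘ I`). [folklore] -/
theorem sum_card_filter_umvirate {n t : ℕ} (X : Finset (Equiv.Perm (Fin n))) (I : Fin t → Fin n) :
    ∑ L : Fin t → Fin n, (X.filter (fun x => ∀ k, x (I k) = L k)).card = X.card := by
  classical
  rw [card_eq_sum_card_fiberwise (f := fun x : Equiv.Perm (Fin n) => fun k => x (I k))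
      (t := (Finset.univ : Finset (Fin t → Fin n))) (fun _ _ => mem_univ _)]
  refine sum_congr rfl fun L _ => ?_
  congr 1
  ext x
  simp only [mem_filter, funext_iff]

/-- **First rung, left factor.** Under a full quotient, a bump of `S⁻¹T` on `U_{I→J}` is at most the
largest bump of `S` on the umvirates `U_{J→L}` with the same source `J`:
`|S⁻¹T ∩ U_{I→J}| ≤ |T| · max_L |S ∩ U_{J→L}|` (alignment identity + `Σ_L |T ∩ U_{I→L}| = |T|`).
[folklore] -/
theorem card_quot_filter_le_left {n t : ℕ} (S T : Finset (Equiv.Perm (Fin n)))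
    (hinj : Set.InjOn (fun st : Equiv.Perm (Fin n) × Equiv.Perm (Fin n) => st.1⁻¹ * st.2)
      ((S : Set (Equiv.Perm (Fin n))) ×ˢ (T : Set (Equiv.Perm (Fin n)))))
    (I J : Fin t → Fin n) (M : ℕ) (hM : ∀ L : Fin t → Fin n, (S.filter (fun s => ∀ k, s (J k) = L k)).card ≤ M) :
    ((Finset.image₂ (fun s τ => s⁻¹ * τ) S T).filter (fun σ => ∀ k, σ (I k) = J k)).card ≤
      M * T.card := by
  rw [card_quot_filter_eq_sum S T hinj I J, ← sum_card_filter_umvirate T I, mul_sum]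
  exact sum_le_sum fun L _ => Nat.mul_le_mul_right _ (hM L)

/-- **First rung, right factor.** Symmetrically `|S⁻¹T ∩ U_{I→J}| ≤ |S| · max_L |T ∩ U_{I→L}|`.
[folklore] -/
theorem card_quot_filter_le_right {n t : ℕ} (S T : Finset (Equiv.Perm (Fin n)))
    (hinj : Set.InjOn (fun st : Equiv.Perm (Fin n) × Equiv.Perm (Fin n) => st.1⁻¹ * st.2)
      ((S : Set (Equiv.Perm (Fin n))) ×ˢ (T : Set (Equiv.Perm (Fin n)))))
    (I J : Fin t → Fin n) (M : ℕ) (hM : ∀ L : Fin t → Fin n, (T.filter (fun τ => ∀ k, τ (I k) = L k)).card ≤ M) :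
    ((Finset.image₂ (fun s τ => s⁻¹ * τ) S T).filter (fun σ => ∀ k, σ (I k) = J k)).card ≤
      S.card * M := by
  rw [card_quot_filter_eq_sum S T hinj I J, ← sum_card_filter_umvirate S J, sum_mul]
  exact sum_le_sum fun L _ => Nat.mul_le_mul_left _ (hM L)

/-- Full quotient as an `InjOn` statement: `|S⁻¹T| = |S|·|T|` iff `(s,t) ↦ s⁻¹t` is injective on
`S × T` (`Finset.card_image₂_iff`). [folklore] -/
theorem injOn_of_card_image₂_eq {n : ℕ} (S T : Finset (Equiv.Perm (Fin n)))
    (h : (Finset.image₂ (fun s τ => s⁻¹ * τ) S T).card = S.card * T.card) :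
    Set.InjOn (fun st : Equiv.Perm (Fin n) × Equiv.Perm (Fin n) => st.1⁻¹ * st.2)
      ((S : Set (Equiv.Perm (Fin n))) ×ˢ (T : Set (Equiv.Perm (Fin n)))) :=
  Finset.card_image₂_iff.1 h

end Summit.MatrixMultiplication.MatrixMultiplication.Theorems.PolynomialSlack
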